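import Literature.AlgebraicGeometry.Motives.TopFormCocycleUnitAt
import HarnessLib

/-!
# The shear cocycle of the coordinate top form `d y₁ ∧ … ∧ d yₙ` factors as (unit) · (pull-back of a
# Jacobian on the factor)

Topic `Literature/AlgebraicGeometry/Motives` (proofs only; no definitions, no named facts), in the
currency of ★ `TopFormCocycleUnitAt` / ★ `RelativeLocalCoordinates`.  This is the local computation
behind the CONSTRUCTION of the invariant volume form of a group scheme (Bosch–Lütkebohmert–
Raynaud, *Néron Models*, §4.2 Prop. 1/2) in the rational currency of the (W0) programme
(W0-CORE-SPEC §3, leaf L4a'): let `Φ : Y → Y` (the shear `(x, y) ↦ (x, xy)`) induce an isomorphism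
of local rings at `q` over the base ring `A`, let `pr₂, μ : Y → X` be dominant with `Φ ≫ pr₂ = μ`
(`μ(x, y) = xy`), and let `p := pr₂ (Φ q) = μ q`.  For rational coordinates `y` on `X` over `R`
(`d yᵢ` a basis `B₀` of `Ω[K(X)⁄R]`; the top form `θ₀ = d y₁ ∧ … ∧ d yₙ`), relative coordinates at `q`
with function-field basis `W`, `W i = d (pr₂^♯ yᵢ)`, and relative coordinates at `Φ q` pulled back
along `pr₂` from coordinates `z` at `p` (function-field basis `Z` on `X`):

* `det_shearCocycle_eq_mul` — **`W.det (d (Φ^♯ pr₂^♯ yᵢ))ᵢ = v · μ^♯ (Z.det B₀)` with `v` a unit at `q`**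
  (`v = W.det W''`, `W''` the coordinates at `q` transported from `Φ q`; two chain rules
  ★ `det_D_ringHom_eq`, along `Φ^♯` and along `pr₂^♯`).

Restricting along the section `x ↦ (x, ε)` (where `μ` restricts to the identity) then exhibits the
coefficient `g₀` with `θ₀ / g₀` a frame at `p` (leaf L4a', next file).  Cell `hodgecm-mathlib`,
road W of `r₀`.

## Sources

* S. Bosch, W. Lütkebohmert, M. Raynaud, *Néron Models*, Springer 1990, §4.2 Prop. 1 and 2
  (construction of invariant differential forms by translation). [BLRNeronModels1990]
-/

noncomputable section

universe u

open CategoryTheory AlgebraicGeometry Opposite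

namespace Literature.AlgebraicGeometry.Motives

open RatFn Literature.RingTheory.Derivation

variable {X Y : Scheme.{u}} [IsIntegral X] [IsIntegral Y] (Φ : Y ⟶ Y) [IsDominant Φ]
  (pr₂ μ : Y ⟶ X) [IsDominant pr₂] [IsDominant μ] (n : ℕ) (R A : Type u) [CommRing R] [CommRing A]
  (τ : R →+* A) (q : Y)
  [Algebra R (X.presheaf.stalk (μ.base q))] [Algebra R X.functionField]
  [IsScalarTower R (X.presheaf.stalk (μ.base q)) X.functionField]
  [Algebra A (Y.presheaf.stalk q)] [Algebra A (Y.presheaf.stalk (Φ.base q))]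
  [Algebra A Y.functionField] [IsScalarTower A (Y.presheaf.stalk q) Y.functionField]

/-- **The shear cocycle of `d y₁ ∧ … ∧ d yₙ` factors as (unit at `q`) · `μ^♯`(Jacobian at `p = μ q`)**
(Bosch–Lütkebohmert–Raynaud §4.2, proof of Prop. 2, in rational currency; see the module
docstring for the notation). [cite: BLRNeronModels1990, §4.2 Prop. 2 (proof)] -/
theorem det_shearCocycle_eq_mul [IsIso (Φ.stalkMap q)] (hμ : Φ ≫ pr₂ = μ)
    (hA : (Φ.stalkMap q).hom.comp (algebraMap A (Y.presheaf.stalk (Φ.base q))) =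
      algebraMap A (Y.presheaf.stalk q))
    (hσA : (functionFieldMap Φ).comp (algebraMap A Y.functionField) = algebraMap A Y.functionField)
    (hφ₂ : (functionFieldMap pr₂).comp (algebraMap R X.functionField) =
      (algebraMap A Y.functionField).comp τ)
    -- coordinates at `p = μ q` over `R`
    {zp : Fin n → X.presheaf.stalk (μ.base q)}
    (bp : Module.Basis (Fin n) (X.presheaf.stalk (μ.base q)) Ω[X.presheaf.stalk (μ.base q)⁄R])
    (hbp : ∀ i, bp i = KaehlerDifferential.D R _ (zp i))
    (Zp : Module.Basis (Fin n) X.functionField Ω[X.functionField⁄R])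
    (hZp : ∀ i, Zp i = KaehlerDifferential.D R _ (toFunctionField (μ.base q) (zp i)))
    -- the rational coordinates `y` of the top form `θ₀ = d y₁ ∧ … ∧ d yₙ`
    {y : Fin n → X.functionField} (B₀ : Module.Basis (Fin n) X.functionField Ω[X.functionField⁄R])
    (hB₀ : ∀ i, B₀ i = KaehlerDifferential.D R _ (y i))
    -- relative coordinates at `q` (any; for `c₀` one takes those with rational values `pr₂^♯ yᵢ`)
    {w : Fin n → Y.presheaf.stalk q}
    (bw : Module.Basis (Fin n) (Y.presheaf.stalk q) Ω[Y.presheaf.stalk q⁄A])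
    (hbw : ∀ i, bw i = KaehlerDifferential.D A _ (w i))
    (W : Module.Basis (Fin n) Y.functionField Ω[Y.functionField⁄A])
    (hW : ∀ i, W i = KaehlerDifferential.D A _ (toFunctionField q (w i)))
    -- relative coordinates at `Φ q` with rational values `pr₂^♯ (zpᵢ)`
    {w' : Fin n → Y.presheaf.stalk (Φ.base q)}
    (bw' : Module.Basis (Fin n) (Y.presheaf.stalk (Φ.base q)) Ω[Y.presheaf.stalk (Φ.base q)⁄A])
    (hbw' : ∀ i, bw' i = KaehlerDifferential.D A _ (w' i))
    (W' : Module.Basis (Fin n) Y.functionField Ω[Y.functionField⁄A])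
    (hW' : ∀ i, W' i = KaehlerDifferential.D A _ (toFunctionField (Φ.base q) (w' i)))
    (hW'z : ∀ i, toFunctionField (Φ.base q) (w' i) =
      functionFieldMap pr₂ (toFunctionField (μ.base q) (zp i))) :
    ∃ v : Y.functionField, IsUnitAt q v ∧
      W.det (fun i => KaehlerDifferential.D A _ (functionFieldMap Φ (functionFieldMap pr₂ (y i)))) =
        v * functionFieldMap μ (Zp.det B₀) := by
  classical
  set σ := functionFieldMap Φ with hσ
  set φ₂ := functionFieldMap pr₂ with hφ₂def
  -- transport the coordinates at `Φ q` to `q`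
  obtain ⟨b'', hb'', hff⟩ := exists_localCoordinates_of_isIso_stalkMap Φ n A q hA bw' hbw'
  obtain ⟨W'', hW''⟩ := exists_basis_functionField_of_localCoordinates' n A b'' hb''
  -- the rational functions `zfn i := pr₂^♯ (zp i)`
  have hW'f : ∀ i, W' i = KaehlerDifferential.D A _ (φ₂ (toFunctionField (μ.base q) (zp i))) :=
    fun i => by rw [hW', hW'z]
  have hW''f : ∀ i, W'' i =
      KaehlerDifferential.D A _ (σ (φ₂ (toFunctionField (μ.base q) (zp i)))) := fun i => by
    rw [hW'', hff, hW'z]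
  -- chain rule along `σ`: `W''.det (d σ vⱼ) = σ (W'.det (d vⱼ))`
  have hchainσ : W''.det (fun j => KaehlerDifferential.D A _ (σ (φ₂ (y j)))) =
      σ (W'.det fun j => KaehlerDifferential.D A _ (φ₂ (y j))) :=
    det_D_ringHom_eq (RingHom.id A) σ (by rw [hσA, RingHom.comp_id]) W' hW'f W'' hW''f (fun j => φ₂ (y j))
  -- chain rule along `φ₂` over `τ`: `W'.det (d φ₂ yⱼ) = φ₂ (Zp.det (d yⱼ))`
  have hchainφ : W'.det (fun j => KaehlerDifferential.D A _ (φ₂ (y j))) =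
      φ₂ (Zp.det fun j => KaehlerDifferential.D R _ (y j)) :=
    det_D_ringHom_eq τ φ₂ hφ₂ Zp hZp W' hW'f y
  have hB₀' : (fun j => KaehlerDifferential.D R X.functionField (y j)) = ⇑B₀ :=
    funext fun j => (hB₀ j).symm
  -- cocycle `W.det v = W.det W'' * W''.det v`
  have hcoc : W.det (fun i => KaehlerDifferential.D A _ (σ (φ₂ (y i)))) =
      W.det W'' * W''.det (fun i => KaehlerDifferential.D A _ (σ (φ₂ (y i)))) := by
    rw [Module.Basis.det_apply, Module.Basis.det_apply, Module.Basis.det_apply, ← Matrix.det_mul,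
      Module.Basis.toMatrix_mul_toMatrix]
  -- `σ ∘ φ₂ = μ^♯`
  subst hμ
  have hσφ : ∀ x, σ (φ₂ x) = functionFieldMap (Φ ≫ pr₂) x := fun x => by
    rw [← RingHom.comp_apply, ← functionFieldMap_comp pr₂ Φ]
  refine ⟨W.det W'', (isUnitAt_det_of_localCoordinates' n A b'' hb'' bw hbw hW'' hW).2, ?_⟩
  rw [hcoc, hchainσ, hchainφ, hB₀', hσφ]

end Literature.AlgebraicGeometry.Motives

end
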